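import Literature.Analysis.PDE.QuasilinearLinearization
import HarnessLib

/-!
# The Picard source of a quasilinear system in a framed chart (topic `Analysis/PDE`)

Layer (III), step 5a, of the programme to prove short-time existence for quasilinear strictly
parabolic systems on a closed manifold (hypothesis `hQL` of
`Literature.Geometry.Riemannian.ricciFlow_shortTime_existence_of_quasilinear`). The frozen
Picard scheme solves `∂ₜ v_{k+1} = L v_{k+1} + Θ(v_k)` with `Θ(v) = P(u₀ + v) - L v`,
`L = DP(u₀)`. This file computes the chart expression of `Θ(v)` in a framed chart `κ` as

  `Θ̂ = Σᵢᵢ' [a(Z) - a(Z₀)]ᵢᵢ' D²v̂ (A bᵢ) (A bᵢ') + G̃(y, 𝔷(y)) + P̂(u₀)`,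

with `Z₀` the base jet, `𝔷 = (v̂, Dv̂)`, `Z = Z₀ + 𝔷`, and the Taylor remainder
`G̃(y, 𝔷) = 𝒩₁(Z₀ + 𝔷) - 𝒩₁(Z₀) - ∂𝒩₁(Z₀) 𝔷` of the chart nonlinearity at the base Hessian
(`thetaRem`): the first term carries the small coefficient of the top order, the second is a
composite with the jet handled by `JetComposition.lean`, the third is a fixed smooth source.

* `frameOp_lin_eq` — the frame operator of the linearisation fields:
  `frameOp S 𝔟 𝔠 v̂ y = Σ a(Z₀) D²v̂ (A b) (A b) + ∂𝒩₁(Z₀) (v̂ y, Dv̂ y)`;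
* `thetaRem`, `thetaRem_zero` — the remainder and `G̃(y, 0) = 0`;
* `chartNonlin_sub_frameOp_eq` — **the identity for `Θ̂`**.

Everything is proved; no named fact and no `sorry` is introduced.

## References

* C. Mantegazza, L. Martinazzi, *A note on quasilinear parabolic equations on manifolds*,
  Ann. Sc. Norm. Super. Pisa Cl. Sci. (5) 11 (2012), 857–874, §3. [MantegazzaMartinazzi2012]
-/

noncomputable section

open Set Function Filter Topology InnerProductSpace
open scoped Manifold ContDiff Topology RealInnerProductSpace

namespace Literature.Analysis.PDE

open Literature.Geometry.Manifold

variable {E : Type*} [NormedAddCommGroup E] [NormedSpace ℝ E] {H : Type*} [TopologicalSpace H]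
variable {I : ModelWithCorners ℝ E H} {M : Type*} [TopologicalSpace M] [ChartedSpace H M]
variable {E' : Type*} [NormedAddCommGroup E'] [InnerProductSpace ℝ E'] [FiniteDimensional ℝ E']
variable {W : Type*} [NormedAddCommGroup W] [NormedSpace ℝ W]
variable {ι : Type*} [Fintype ι]
variable (κ : FramedChart I M E') (b : Module.Basis ι ℝ E)
  (a : M → E × W × (E →L[ℝ] W) → ι → ι → ℝ) (f : M → E × W × (E →L[ℝ] W) → W) (u₀ : M → W)

/-- The chart nonlinearity at the base Hessian as a function of the jet at the point `y`:
`𝒩₁(J) = chartNonlin y J.1 J.2 (H₀ y)`. [cite: MantegazzaMartinazzi2012, §3] -/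
def nonlinBase (y : E') (J : W × (E' →L[ℝ] W)) : W := κ.chartNonlin b a f y J.1 J.2 (baseHess κ u₀ y)

/-- **The Taylor remainder of the chart nonlinearity at the base jet**:
`G̃(y, 𝔷) = 𝒩₁(Z₀ + 𝔷) - 𝒩₁(Z₀) - ∂𝒩₁(Z₀) 𝔷`. [cite: MantegazzaMartinazzi2012, §3] -/
def thetaRem (y : E') (𝔷 : W × (E' →L[ℝ] W)) : W :=
  nonlinBase κ b a f u₀ y (baseJet κ u₀ y + 𝔷) - nonlinBase κ b a f u₀ y (baseJet κ u₀ y) - linDZ κ b a f u₀ y 𝔷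

omit [FiniteDimensional ℝ E'] in
/-- `thetaRem_zero`: the remainder vanishes at `𝔷 = 0`. [folklore] -/
theorem thetaRem_zero (y : E') : thetaRem κ b a f u₀ y 0 = 0 := by
  simp [thetaRem]

omit [FiniteDimensional ℝ E'] in
/-- `nonlinBase` and `linDZ`: the latter is the derivative of the former at the base jet.
[folklore] -/
theorem linDZ_eq_fderiv_nonlinBase (y : E') : linDZ κ b a f u₀ y = fderiv ℝ (nonlinBase κ b a f u₀ y) (baseJet κ u₀ y) := rfl

/-- **The frame operator of the linearisation fields**: for `v̂` of class `C²` on the target and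
`y ∈ κ.target`,
`frameOp (linSymb y) (linFirst y) (linZero y) v̂ y = Σᵢᵢ' a(Z₀)ᵢᵢ' D²v̂(y) (A bᵢ) (A bᵢ') + ∂𝒩₁(Z₀) (v̂ y, Dv̂ y)`.
[cite: MantegazzaMartinazzi2012, §3] -/
theorem frameOp_lin_eq [I.Boundaryless] {w : E' → W} (hw : ContDiffOn ℝ 2 w κ.target) {y : E'} (hy : y ∈ κ.target) :
    frameOp (linSymb κ b a u₀ y) (linFirst κ b a f u₀ y) (linZero κ b a f u₀ y) w y =
      (∑ i, ∑ i', a κ.z (κ.jetBack y (baseJet κ u₀ y).1 (baseJet κ u₀ y).2) i i' • fderiv ℝ (fderiv ℝ w) y (κ.A (b i)) (κ.A (b i'))) +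
        linDZ κ b a f u₀ y (w y, fderiv ℝ w y) := by
  rw [frameOp_apply, linSymb, principalPart_symbOp κ b _ κ.isOpen_target hy hw, add_assoc]
  congr 1
  simp only [linFirst, linZero, ContinuousLinearMap.coe_comp, Function.comp_apply, ContinuousLinearMap.inl_apply, ContinuousLinearMap.inr_apply,
    ← map_add, Prod.mk_add_mk, add_zero, add_comm]

omit [FiniteDimensional ℝ E'] in
/-- **The identity for the Picard source in the framed chart.** With `Z₀` the base jet, `H₀`
the base Hessian, a jet increment `𝔷` and a Hessian increment `Ĥ`:
`chartNonlin y (Z₀ + 𝔷) (H₀ + Ĥ) - [Σ a(Z₀) Ĥ (A b) (A b) + ∂𝒩₁(Z₀) 𝔷]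
  = Σ [a(Z₀ + 𝔷) - a(Z₀)] Ĥ (A b) (A b) + G̃(y, 𝔷) + chartNonlin y Z₀ H₀`.
[cite: MantegazzaMartinazzi2012, §3] -/
theorem chartNonlin_sub_lin_eq (y : E') (𝔷₁ : W) (𝔷₂ : E' →L[ℝ] W) (Ĥ : E' →L[ℝ] E' →L[ℝ] W) :
    κ.chartNonlin b a f y ((baseJet κ u₀ y).1 + 𝔷₁) ((baseJet κ u₀ y).2 + 𝔷₂) (baseHess κ u₀ y + Ĥ) -
      ((∑ i, ∑ i', a κ.z (κ.jetBack y (baseJet κ u₀ y).1 (baseJet κ u₀ y).2) i i' • Ĥ (κ.A (b i)) (κ.A (b i'))) + linDZ κ b a f u₀ y (𝔷₁, 𝔷₂)) =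
      (∑ i, ∑ i', (a κ.z (κ.jetBack y ((baseJet κ u₀ y).1 + 𝔷₁) ((baseJet κ u₀ y).2 + 𝔷₂)) i i' -
          a κ.z (κ.jetBack y (baseJet κ u₀ y).1 (baseJet κ u₀ y).2) i i') • Ĥ (κ.A (b i)) (κ.A (b i'))) +
        thetaRem κ b a f u₀ y (𝔷₁, 𝔷₂) + κ.chartNonlin b a f y (baseJet κ u₀ y).1 (baseJet κ u₀ y).2 (baseHess κ u₀ y) := by
  simp only [thetaRem, nonlinBase, FramedChart.chartNonlin_apply, Prod.fst_add, Prod.snd_add, FunLike.coe_add, Pi.add_apply, smul_add, sub_smul,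
    Finset.sum_add_distrib, Finset.sum_sub_distrib]
  abel

/-- **The chart expression of the Picard source.** Let `P` be represented in the extended chart
at `z` on smooth maps with graph in `𝒪` (hypothesis of `hQL` at `z`), `u₀, v` smooth,
`u₀` and `u₀ + v` with graph in `𝒪`, `y ∈ κ.target`. Then, with `û₀ = u₀ ∘ κ⁻¹`, `v̂ = v ∘ κ⁻¹`,
`𝔷 = (v̂ y, Dv̂ y)`:
`P (u₀ + v) (κ⁻¹ y) - L v (κ⁻¹ y)
  = Σ [a(jetBack y (Z₀ + 𝔷)) - a(jetBack y Z₀)] D²v̂(y) (A b) (A b) + G̃(y, 𝔷) + P u₀ (κ⁻¹ y)`.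
[cite: MantegazzaMartinazzi2012, §3] -/
theorem apply_sub_linOp_eq [CompactSpace M] [I.Boundaryless] [IsManifold I ∞ M] {𝒪 : Set (M × W)} {P : (M → W) → M → W}
    (h𝒪 : IsOpen 𝒪)
    (ha : ∀ i i', ContDiffOn ℝ ∞ (fun j ↦ a κ.z j i i') {j | j.1 ∈ (extChartAt I κ.z).target ∧ ((extChartAt I κ.z).symm j.1, j.2.1) ∈ 𝒪})
    (hf : ContDiffOn ℝ ∞ (f κ.z) {j | j.1 ∈ (extChartAt I κ.z).target ∧ ((extChartAt I κ.z).symm j.1, j.2.1) ∈ 𝒪})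
    (hP : ∀ u : M → W, ContMDiff I 𝓘(ℝ, W) ∞ u → (∀ x, (x, u x) ∈ 𝒪) → ∀ η ∈ (extChartAt I κ.z).target,
      P u ((extChartAt I κ.z).symm η) =
        (∑ i, ∑ i', a κ.z (η, u ((extChartAt I κ.z).symm η), fderiv ℝ (u ∘ (extChartAt I κ.z).symm) η) i i' •
          fderiv ℝ (fderiv ℝ (u ∘ (extChartAt I κ.z).symm)) η (b i) (b i')) +
        f κ.z (η, u ((extChartAt I κ.z).symm η), fderiv ℝ (u ∘ (extChartAt I κ.z).symm) η))
    (hu₀ : ContMDiff I 𝓘(ℝ, W) ∞ u₀) (hg₀ : ∀ x, (x, u₀ x) ∈ 𝒪) {v : M → W} (hv : ContMDiff I 𝓘(ℝ, W) ∞ v)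
    (hgv : ∀ x, (x, u₀ x + v x) ∈ 𝒪) {y : E'} (hy : y ∈ κ.target) :
    P (fun x ↦ u₀ x + v x) (κ.inv y) - linOp P u₀ v (κ.inv y) =
      (∑ i, ∑ i', (a κ.z (κ.jetBack y ((baseJet κ u₀ y).1 + (v ∘ κ.inv) y) ((baseJet κ u₀ y).2 + fderiv ℝ (v ∘ κ.inv) y)) i i' -
          a κ.z (κ.jetBack y (baseJet κ u₀ y).1 (baseJet κ u₀ y).2) i i') • fderiv ℝ (fderiv ℝ (v ∘ κ.inv)) y (κ.A (b i)) (κ.A (b i'))) +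
        thetaRem κ b a f u₀ y ((v ∘ κ.inv) y, fderiv ℝ (v ∘ κ.inv) y) + P u₀ (κ.inv y) := by
  have huh : ContDiffOn ℝ ∞ (u₀ ∘ κ.inv) κ.target := κ.contDiffOn_comp_inv hu₀
  have hvh : ContDiffOn ℝ ∞ (v ∘ κ.inv) κ.target := κ.contDiffOn_comp_inv hv
  have hT := κ.isOpen_target
  have hyn : κ.target ∈ 𝓝 y := hT.mem_nhds hy
  -- the representation of `P (u₀ + v)` and of `P u₀`
  have huv : ContMDiff I 𝓘(ℝ, W) ∞ fun x ↦ u₀ x + v x := hu₀.add hv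
  have huvh : ContDiffOn ℝ ∞ ((fun x ↦ u₀ x + v x) ∘ κ.inv) κ.target := κ.contDiffOn_comp_inv huv
  have h1 := κ.apply_inv_eq_chartNonlin b (hP _ huv hgv) hT (huvh.of_le (by norm_cast)) hy hy
  have h0 := κ.apply_inv_eq_chartNonlin b (hP _ hu₀ hg₀) hT (huh.of_le (by norm_cast)) hy hy
  -- the jet of `u₀ + v` at `y`
  have hdu : DifferentiableAt ℝ (u₀ ∘ κ.inv) y := (huh.differentiableOn (by simp)).differentiableAt hyn
  have hdv : DifferentiableAt ℝ (v ∘ κ.inv) y := (hvh.differentiableOn (by simp)).differentiableAt hyn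
  have hDu : ContDiffOn ℝ ∞ (fderiv ℝ (u₀ ∘ κ.inv)) κ.target := huh.fderiv_of_isOpen hT (by norm_cast)
  have hDv : ContDiffOn ℝ ∞ (fderiv ℝ (v ∘ κ.inv)) κ.target := hvh.fderiv_of_isOpen hT (by norm_cast)
  have hdDu : DifferentiableAt ℝ (fderiv ℝ (u₀ ∘ κ.inv)) y := (hDu.differentiableOn (by simp)).differentiableAt hyn
  have hdDv : DifferentiableAt ℝ (fderiv ℝ (v ∘ κ.inv)) y := (hDv.differentiableOn (by simp)).differentiableAt hyn
  have hfun : (fun x ↦ u₀ x + v x) ∘ κ.inv = fun y' ↦ (u₀ ∘ κ.inv) y' + (v ∘ κ.inv) y' := rfl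
  have hval : u₀ (κ.inv y) + v (κ.inv y) = (baseJet κ u₀ y).1 + (v ∘ κ.inv) y := rfl
  have hD : fderiv ℝ ((fun x ↦ u₀ x + v x) ∘ κ.inv) y = (baseJet κ u₀ y).2 + fderiv ℝ (v ∘ κ.inv) y := by
    rw [hfun, fderiv_fun_add hdu hdv]; rfl
  have hDD : fderiv ℝ (fderiv ℝ ((fun x ↦ u₀ x + v x) ∘ κ.inv)) y = baseHess κ u₀ y + fderiv ℝ (fderiv ℝ (v ∘ κ.inv)) y := by
    have hev : fderiv ℝ ((fun x ↦ u₀ x + v x) ∘ κ.inv) =ᶠ[𝓝 y] fun y' ↦ fderiv ℝ (u₀ ∘ κ.inv) y' + fderiv ℝ (v ∘ κ.inv) y' := by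
      filter_upwards [hyn] with y' hy'
      have hdu' : DifferentiableAt ℝ (u₀ ∘ κ.inv) y' := (huh.differentiableOn (by simp)).differentiableAt (hT.mem_nhds hy')
      have hdv' : DifferentiableAt ℝ (v ∘ κ.inv) y' := (hvh.differentiableOn (by simp)).differentiableAt (hT.mem_nhds hy')
      rw [hfun, fderiv_fun_add hdu' hdv']
    rw [hev.fderiv_eq, fderiv_fun_add hdDu hdDv]; rfl
  rw [h1, hval, hD, hDD, linOp_inv_eq_frameOp (κ := κ) (b := b) (a := a) (f := f) (u₀ := u₀) h𝒪 ha hf hP hu₀ hg₀ hv hy,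
    frameOp_lin_eq κ b a f u₀ (hvh.of_le (by norm_cast)) hy, chartNonlin_sub_lin_eq, h0]
  rfl

end Literature.Analysis.PDE
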